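import Summits.QuantumFields.BalabanUV.T4Continuum.Support.NE3EnergyChartLeavesSockets
import Summits.QuantumFields.BalabanUV.T4Continuum.Support.NE3EnergyWeightedSupShape
import HarnessLib

/-!
# T⁴ programme, node NE3 — T-E_w♯ FROM THE CHART'S LEAVES: the decaying sup conjunct of `NE3EnergyRateWSup` is ALREADY a
# hypothesis of the chart composition (`NE3EnergyChartLeavesSockets.ne3EnergyRateW_of_chartLeaves`), so the same leaves give
# the strengthened root with the displayed prefactor `s = (√Λ − 1)∕(24√d)`

NE3 prover lineage P1, gen 20 (cell `pub-balaban`, unit `b2b-balaban-t4-ne3-p1`, row NE3 OWNER).  CONTEXT: the weighted crude (D)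
END (`NE3LocalCrudeWEnd`, this gen) consumes T-E_w♯ = `NE3EnergyWeightedSupShape.NE3EnergyRateWSup d 𝒞 L N b g C s dom`
(T-E_w + `‖Z(b)‖ ≤ s·(L⁻¹)^k` inside the `∃(u,Z)`).  The crew's chart composition (leaf-03 g5, S5-Y0-chart 3∕3) derives T-E_w from
the chart leaves under the k-uniformity datum `(1 + 24√d·(e^{α_k} − 1)·L^k)² + 48·d·a_k·(L^k)² ≤ Λ` on the sup-radius `α_k` of the
PATH `Γ` (all times `t`, in particular `t = 0` where `Γ 0 = Z`).  THIS FILE observes that this datum already forces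
`α_k ≤ ((√Λ − 1)∕(24√d))·(L⁻¹)^k` (`α ≤ e^α − 1`), hence:

* §1 `sup_le_of_lambdaW` — the arithmetic: `0 ≤ α`, `0 ≤ a`, `1 ≤ d`, `1 ≤ L` and the displayed datum give
  `α ≤ ((√Λ − 1)∕(24√d))·(L⁻¹)^k`;
* §2 **`ne3EnergyRateWSup_of_chartLeaves`** — under EXACTLY the hypotheses of `ne3EnergyRateW_of_chartLeaves` (plus `1 ≤ d`):
  **`NE3EnergyRateWSup d 𝒞 L N b g ((1+θ₀)·(2∕c)·C′) ((√Λ − 1)∕(24√d)) dom`**.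

CONSEQUENCE FOR THE ROW (skeleton v1.10): the local half on the fixed torus, reading (D), is a KERNEL COMPOSITION from
(H∃)[choice] ∧ {chart leaves (L1 REP, L2 PATH with `coer` = (ML_w) along the path), (RES♯), the level data (α_k, a_k) with the
Λ-bound} — `NE3LocalCrudeWEnd.ne3Shape_classSix_of_energyRateWSup ∘ ne3EnergyRateWSup_of_chartLeaves`; NO separate sup supplier is
needed for the conjunct (the crew's E-SUP module then discharges the level datum `α_k`, not a new hypothesis).

HONEST FRAMING.  Kernel bookkeeping; the chart leaves, (ML_w), (RES♯) and the level data are HYPOTHESES (ours, unprinted as such);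
NOTHING about Bałaban's minimisers is proved; T-E_w♯ ∕ T-E_w NOT proved; NE3 NOT proved; spine PROVED 0∕9; finite T⁴ rung (B)+1 —
NOT infinite volume, NOT mass gap, NOT `BetaPertH`, NOT Clay.  No `def`, no `sorry`.  PLACEMENT: `Summits/QuantumFields/BalabanUV/`.
HONEST DEPENDENCY (cell page 1): continuum YM on T⁴ ⇐ BetaPertH ∧ nine spine estimates (0/9 proved); BetaPertH ⇐ (D1) ∧ (D4) ∧
CAP+tail; G-an2-4 gates asym, D1 and NE2/3/4.
-/

set_option autoImplicit false

open scoped BigOperators Matrix.Norms.L2Operator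
open NormedSpace Finset

namespace Summit.QuantumFields.BalabanUV.T4Continuum.NE3EnergyRateWSupOfChart

open Set
open Literature.MathematicalPhysics.QuantumFieldTheory.Balaban1983to89
open B7Prop1Explicit B7Prop2Explicit
open T4AveragingDeficitWall hiding Site Plane Plaq Bond
open T4AveragingDeficitWallBoundary (periodBox)
open AveragingDeficitPeriodicCounting (IsPeriodicDir)
open AveragingDeficitChartCalculus (cavg)
open MinimalActionSandwich (IsMinimiser)
open MinimalActionRate (Regular)
open NE3EnergyShapes (residualScale residualScale_nonneg)
open NE3EnergyChartLeaves (ChartLeaves)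
open NE3EnergyWeightedShapes (energyNormW CurlPairedResidual)
open NE3EnergyWeightedSupShape (NE3EnergyRateWSup)
open NE3EnergyChartLeavesSockets (energyNormW_le_of_chartLeaves)

noncomputable section

variable {d : ℕ} {n : Type*} [Fintype n] [DecidableEq n]

/-! ## §1 The level datum forces a decaying sup-radius -/

omit [Fintype n] [DecidableEq n] in
/-- **THE Λ-DATUM FORCES `α ≤ ((√Λ − 1)∕(24√d))·(L⁻¹)^k`**: from `(1 + 24√d·(e^α − 1)·L^k)² + 48·d·a·(L^k)² ≤ Λ` with `0 ≤ α`,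
`0 ≤ a`, `1 ≤ d`, `1 ≤ L` (drop the `a`-term, take square roots, use `α ≤ e^α − 1`). [folklore] -/
theorem sup_le_of_lambdaW (hd : 1 ≤ d) {L : ℕ} (hL : 1 ≤ L) (k : ℕ) {α a Λ : ℝ} (hα : 0 ≤ α) (ha : 0 ≤ a)
    (hΛw : (1 + 24 * Real.sqrt d * (Real.exp α - 1) * (L : ℝ) ^ k) ^ 2 + 48 * d * a * ((L : ℝ) ^ k) ^ 2 ≤ Λ) :
    α ≤ (Real.sqrt Λ - 1) / (24 * Real.sqrt d) * ((L : ℝ)⁻¹) ^ k := by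
  have hL0 : (0 : ℝ) < L := by exact_mod_cast (show 0 < L by omega)
  have hs : (0 : ℝ) < (L : ℝ) ^ k := pow_pos hL0 k
  have hd0 : (0 : ℝ) < Real.sqrt d := Real.sqrt_pos.mpr (by exact_mod_cast (show 0 < d by omega))
  have hE : 0 ≤ Real.exp α - 1 := by have := Real.add_one_le_exp α; linarith
  set B : ℝ := 1 + 24 * Real.sqrt d * (Real.exp α - 1) * (L : ℝ) ^ k with hB
  have hB0 : 0 ≤ B := by rw [hB]; positivity
  have h1 : B ^ 2 ≤ Λ := by
    have : 0 ≤ 48 * (d : ℝ) * a * ((L : ℝ) ^ k) ^ 2 := by positivity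
    linarith
  have h2 : B ≤ Real.sqrt Λ := by
    rw [show B = Real.sqrt (B ^ 2) by rw [Real.sqrt_sq hB0]]
    exact Real.sqrt_le_sqrt h1
  -- `24√d·α·L^k ≤ 24√d·(e^α − 1)·L^k = B − 1 ≤ √Λ − 1`
  have h3 : α ≤ Real.exp α - 1 := by have := Real.add_one_le_exp α; linarith
  have h4 : 24 * Real.sqrt d * α * (L : ℝ) ^ k ≤ Real.sqrt Λ - 1 := by
    have h5 : 24 * Real.sqrt d * α * (L : ℝ) ^ k ≤ 24 * Real.sqrt d * (Real.exp α - 1) * (L : ℝ) ^ k := by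
      have := mul_le_mul_of_nonneg_left h3 (by positivity : (0 : ℝ) ≤ 24 * Real.sqrt d * (L : ℝ) ^ k)
      calc 24 * Real.sqrt d * α * (L : ℝ) ^ k = 24 * Real.sqrt d * (L : ℝ) ^ k * α := by ring
        _ ≤ 24 * Real.sqrt d * (L : ℝ) ^ k * (Real.exp α - 1) := this
        _ = 24 * Real.sqrt d * (Real.exp α - 1) * (L : ℝ) ^ k := by ring
    have h6 : B - 1 = 24 * Real.sqrt d * (Real.exp α - 1) * (L : ℝ) ^ k := by rw [hB]; ring
    linarith
  have hden : (0 : ℝ) < 24 * Real.sqrt d * (L : ℝ) ^ k := by positivity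
  have h7 : α ≤ (Real.sqrt Λ - 1) / (24 * Real.sqrt d * (L : ℝ) ^ k) := by
    rw [le_div_iff₀ hden]
    calc α * (24 * Real.sqrt d * (L : ℝ) ^ k) = 24 * Real.sqrt d * α * (L : ℝ) ^ k := by ring
      _ ≤ Real.sqrt Λ - 1 := h4
  have e : (Real.sqrt Λ - 1) / (24 * Real.sqrt d * (L : ℝ) ^ k)
      = (Real.sqrt Λ - 1) / (24 * Real.sqrt d) * ((L : ℝ)⁻¹) ^ k := by
    rw [inv_pow]
    field_simp
  rw [← e]
  exact h7

/-! ## §2 T-E_w♯ from the chart's leaves -/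

/-- **THE STRENGTHENED ROOT T-E_w♯ FROM THE CHART'S LEAVES** (`d ≥ 1`): under EXACTLY the hypotheses of
`NE3EnergyChartLeavesSockets.ne3EnergyRateW_of_chartLeaves` — at every level `k ≥ 1`, datum `V ∈ dom` and minimiser pair
`(U_A, U_B)` with `U_B` `Regular b g (k+1)`: the background `cavg L U_B` unitary, chart leaves in `energyNormW L k` with uniform
`(c, θ, κ, θ₀)` (`coer` = (ML_w) along the path), level data `(α_k, a_k)` with `(1 + 24√d·(e^{α_k} − 1)·L^k)² + 48·d·a_k·(L^k)² ≤ Λ`,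
the path's sup-radius `‖Γ t (b)‖ ≤ α_k`, and (RES♯) with `r = C′·residualScale d L N b g k`; `0 ≤ θ₀`, `0 < c`, `0 ≤ C′`, budget
`2Λθ + Λθ² + κ ≤ c∕2` — THEN **`NE3EnergyRateWSup d 𝒞 L N b g ((1+θ₀)·(2∕c)·C′) ((√Λ − 1)∕(24√d)) dom`**: the energy conjunct as
in the crew's theorem, the sup conjunct for `Z = Γ 0` by §1.  NOTHING is proved about the leaves; NE3 NOT proved. [folklore] -/
theorem ne3EnergyRateWSup_of_chartLeaves [Nonempty n] (hd : 1 ≤ d) {𝒞 : ℕ → Set (Site d → Fin d → (Matrix n n ℂ)ˣ)} {L N : ℕ}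
    (hL : 1 ≤ L) (hN : 1 ≤ N) {b g : ℝ} {dom : Set (Site d → Fin d → (Matrix n n ℂ)ˣ)} {c Λ θ κ θ₀ C' : ℝ}
    (hθ₀ : 0 ≤ θ₀) (hc : 0 < c) (hC' : 0 ≤ C') (hbudget : 2 * Λ * θ + Λ * θ ^ 2 + κ ≤ c / 2)
    (hchart : ∀ k : ℕ, 1 ≤ k → ∀ V ∈ dom, ∀ UA UB : Site d → Fin d → (Matrix n n ℂ)ˣ,
      IsMinimiser d 𝒞 L N k V UA → IsMinimiser d 𝒞 L N (k + 1) V UB → Regular d L N b g (k + 1) UB →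
        IsUnitaryCfg (cavg L UB) ∧
        ∃ (u : Site d → (Matrix n n ℂ)ˣ) (Γ Ψ Ψ' : ℝ → Site d → Fin d → Matrix n n ℂ)
          (T : Set (Site d → Fin d → Matrix n n ℂ)) (α a : ℝ), 0 ≤ α ∧ 0 ≤ a ∧
          ChartLeaves 𝒞 L N k V UA UB u Γ Ψ Ψ' T
            (fun Y => energyNormW L k (cavg L UB) Y (periodBox (N * L ^ k))) c θ κ θ₀ a ∧
          (∀ t (x : Site d) (μ : Fin d), ‖Γ t x μ‖ ≤ α) ∧
          (1 + 24 * Real.sqrt d * (Real.exp α - 1) * (L : ℝ) ^ k) ^ 2 + 48 * d * a * ((L : ℝ) ^ k) ^ 2 ≤ Λ ∧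
          CurlPairedResidual L k (cavg L UB) T (C' * residualScale d L N b g k) (periodBox (N * L ^ k))) :
    NE3EnergyRateWSup d 𝒞 L N b g ((1 + θ₀) * (2 / c) * C') ((Real.sqrt Λ - 1) / (24 * Real.sqrt d)) dom := by
  intro k hk V hV UA UB hA hB hreg
  obtain ⟨hW, u, Γ, Ψ, Ψ', T, α, a, hα, ha0, h, hΓα, hΛw, hres⟩ := hchart k hk V hV UA UB hA hB hreg
  have hr : 0 ≤ C' * residualScale d L N b g k := mul_nonneg hC' (residualScale_nonneg d L N b g k)
  have hend := energyNormW_le_of_chartLeaves hL hN hW hα ha0 h hΓα hΛw hres hA hθ₀ hr hc hbudget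
  have hsup := sup_le_of_lambdaW hd hL k hα ha0 hΛw
  refine ⟨u, Γ 0, h.gauge.1, h.gauge.2, h.skew 0, h.per 0, ?_, ?_, fun x μ => (hΓα 0 x μ).trans hsup⟩
  · exact h.rep
  · have hcv : cavg L UB = rescale L (bavg L UB) := rfl
    rw [hcv] at hend
    refine hend.trans (le_of_eq ?_)
    ring

end

end Summit.QuantumFields.BalabanUV.T4Continuum.NE3EnergyRateWSupOfChart
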